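import Mathlib.Combinatorics.SimpleGraph.Acyclic
import Mathlib.Combinatorics.SimpleGraph.Hasse
import Mathlib.Order.Interval.Set.OrdConnected
import HarnessLib

/-!
# Tree decompositions and treewidth

Robertson–Seymour tree decompositions of a simple graph and the treewidth, in the form used by
Markov–Shi (*Simulating quantum computation by contracting tensor networks*, §2):

"A tree decomposition of `G` is a tree `𝒯`, together with a function that maps each vertex
`w ∈ V(𝒯)` to a subset `B_w ⊆ V(G)`. These subsets `B_w` are called bags. In addition, the
following conditions must hold. (T1) `⋃_{v ∈ V(𝒯)} B_v = V(G)`. (T2) for every edge `{u, v}`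
there is `w` with `{u, v} ⊆ B_w`. (T3) for every `u ∈ V(G)` the set of vertices `w ∈ V(𝒯)`
with `u ∈ B_w` form a connected subtree. The width of a tree decomposition is
`max_w |B_w| - 1`. The treewidth of `G` is the minimum width over its tree decompositions."

* `TreeDecomposition G ι` — a tree on the index type `ι` (Mathlib's `SimpleGraph.IsTree`) with
  finite bags `bag : ι → Finset V`; (T2) is the field `exists_mem_bag_of_adj`; (T1) and (T3)
  together are the field `connected_induce` (the induced subgraph of the tree on
  `{t | v ∈ bag t}` is connected, in particular nonempty); `exists_mem_bag` is (T1).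
* `TreeDecomposition.width` (finite index type), `TreeDecomposition.trivial` (one bag holding
  every vertex), `treewidth G` for a finite graph: the least width of a tree decomposition
  indexed by some `Fin k` (every finite tree is isomorphic to one on `Fin k`, so this is the
  treewidth; infinite index trees are irrelevant for finite graphs), `treewidth_le_width`,
  `treewidth_le_card_sub_one`.
* Path decompositions: `isTree_pathGraph` (Mathlib's `SimpleGraph.pathGraph (k+1)` is a tree),
  `connected_induce_pathGraph` (a nonempty order-connected set of vertices of a path induces a
  connected subgraph), `TreeDecomposition.ofIntervals` (bags `B₀, …, B_{k}` along a path form a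
  tree decomposition as soon as every edge lies in a bag and every vertex occupies a nonempty
  interval of bags) and `treewidth_le_of_intervals`; `treewidth_le_of_grid` (the same for bags
  `B i j` on an `N × n` grid read row by row, intervals being lexicographic).

Parallel edges and loops play no role for treewidth, so simple graphs suffice. Mathlib has
`SimpleGraph.IsTree`, `SimpleGraph.pathGraph`, `SimpleGraph.induce`, `Set.OrdConnected` but no
tree decompositions or treewidth (searched `treewidth`, `TreeDecomposition`, `pathwidth`).

## References

* [RobertsonSeymour1986] N. Robertson, P. D. Seymour, *Graph minors. II. Algorithmic aspects
  of tree-width*, J. Algorithms 7 (1986) 309–322 (the original definition of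
  tree-decomposition, width and tree-width; not re-read for this file — the decls cite the form
  printed by Markov–Shi).
* [MarkovShi2008] I. L. Markov, Y. Shi, *Simulating quantum computation by contracting tensor
  networks*, SIAM J. Comput. 38 (2008) 963–981, §2 (Notation and definitions: treewidth of a
  graph). Read via `lit read paper:arxiv-quant-ph_0511069` (p. 5).
-/

namespace Literature.Combinatorics.SimpleGraph

open _root_.SimpleGraph

variable {V : Type*}

/-- A **tree decomposition** of the simple graph `G` indexed by `ι`: a tree on `ι` and a bag of
vertices of `G` at every tree vertex such that (T2) the two ends of every edge of `G` lie in a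
common bag and (T1)+(T3) for every vertex `v` of `G` the tree vertices whose bags contain `v`
induce a connected (in particular nonempty) subgraph of the tree. Bags are finite sets (the
graphs of interest are finite). [cite: MarkovShi2008, §2 (treewidth of a graph, (T1)–(T3))] -/
structure TreeDecomposition (G : _root_.SimpleGraph V) (ι : Type*) where
  /-- The tree of the decomposition, a simple graph on the index type. -/
  tree : _root_.SimpleGraph ι
  /-- The index graph is a tree. -/
  isTree : tree.IsTree
  /-- The bag of vertices of `G` at each tree vertex. -/
  bag : ι → Finset V
  /-- (T2): both ends of an edge of `G` lie in a common bag. -/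
  exists_mem_bag_of_adj : ∀ ⦃u v : V⦄, G.Adj u v → ∃ t, u ∈ bag t ∧ v ∈ bag t
  /-- (T1)+(T3): the tree vertices whose bags contain `v` induce a connected subtree. -/
  connected_induce : ∀ v : V, (tree.induce {t | v ∈ bag t}).Connected

namespace TreeDecomposition

variable {G : _root_.SimpleGraph V} {ι : Type*}

/-- (T1): every vertex of `G` lies in some bag. [cite: MarkovShi2008, §2 ((T1))] -/
theorem exists_mem_bag (D : TreeDecomposition G ι) (v : V) : ∃ t, v ∈ D.bag t := by
  obtain ⟨⟨t, ht⟩⟩ := (D.connected_induce v).nonempty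
  exact ⟨t, ht⟩

/-- The **width** of a tree decomposition with finitely many bags: the largest bag size minus
one ("`max_{w ∈ V(𝒯)} |B_w| - 1`"; natural-number subtraction, so the width of a decomposition
all of whose bags are empty — possible only for the graph on no vertices — is `0`).
[cite: MarkovShi2008, §2 (width of a tree decomposition)] -/
def width [Fintype ι] (D : TreeDecomposition G ι) : ℕ :=
  (Finset.univ.sup fun t => (D.bag t).card) - 1

/-- Every bag has at most `width + 1` vertices. [cite: MarkovShi2008, §2] -/
theorem card_bag_le_width_add_one [Fintype ι] (D : TreeDecomposition G ι) (t : ι) :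
    (D.bag t).card ≤ D.width + 1 := by
  have h : (D.bag t).card ≤ Finset.univ.sup fun t => (D.bag t).card :=
    Finset.le_sup (f := fun t => (D.bag t).card) (Finset.mem_univ t)
  unfold width
  omega

/-- A decomposition all of whose bags have at most `w + 1` vertices has width at most `w`.
[cite: MarkovShi2008, §2] -/
theorem width_le [Fintype ι] (D : TreeDecomposition G ι) {w : ℕ}
    (h : ∀ t, (D.bag t).card ≤ w + 1) : D.width ≤ w := by
  have : (Finset.univ.sup fun t => (D.bag t).card) ≤ w + 1 := Finset.sup_le fun t _ => h t
  unfold width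
  omega

/-- The **trivial tree decomposition** of a finite graph: a single tree vertex whose bag holds
every vertex. [folklore] -/
def trivial [Fintype V] (G : _root_.SimpleGraph V) : TreeDecomposition G (Fin 1) where
  tree := ⊥
  isTree := IsTree.of_subsingleton
  bag _ := Finset.univ
  exists_mem_bag_of_adj _ _ _ := ⟨0, Finset.mem_univ _, Finset.mem_univ _⟩
  connected_induce v :=
    (connected_iff _).2 ⟨fun a b => by rw [Subsingleton.elim a b], ⟨⟨0, Finset.mem_univ v⟩⟩⟩

/-- The trivial decomposition has width `|V| - 1`. [folklore] -/
theorem width_trivial [Fintype V] (G : _root_.SimpleGraph V) :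
    (trivial G).width = Fintype.card V - 1 := by
  simp [width, trivial]

end TreeDecomposition

/-- The **treewidth** of a finite simple graph: the least width of a tree decomposition of `G`
("the minimum width over its tree decompositions"). The decompositions are indexed by the types
`Fin k`; every finite tree is isomorphic to a tree on some `Fin k`, and a decomposition of a
finite graph over an infinite tree restricts to a finite subtree, so nothing is lost. The set of
widths is nonempty (`TreeDecomposition.trivial`), so the infimum is attained
(`exists_width_eq_treewidth`). [cite: MarkovShi2008, §2 (treewidth of a graph)] -/
noncomputable def treewidth [Fintype V] (G : _root_.SimpleGraph V) : ℕ :=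
  sInf {w | ∃ (k : ℕ) (D : TreeDecomposition G (Fin k)), D.width = w}

section treewidth

variable [Fintype V] (G : _root_.SimpleGraph V)

/-- The treewidth is at most the width of any (finitely indexed) tree decomposition.
[cite: MarkovShi2008, §2] -/
theorem treewidth_le_width {G : _root_.SimpleGraph V} {k : ℕ} (D : TreeDecomposition G (Fin k)) :
    treewidth G ≤ D.width :=
  Nat.sInf_le ⟨k, D, rfl⟩

/-- The treewidth is attained by some tree decomposition. [cite: MarkovShi2008, §2] -/
theorem exists_width_eq_treewidth :
    ∃ (k : ℕ) (D : TreeDecomposition G (Fin k)), D.width = treewidth G :=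
  Nat.sInf_mem (s := {w | ∃ (k : ℕ) (D : TreeDecomposition G (Fin k)), D.width = w})
    ⟨_, 1, TreeDecomposition.trivial G, rfl⟩

/-- `treewidth G ≤ |V| - 1` (the trivial decomposition). [folklore] -/
theorem treewidth_le_card_sub_one : treewidth G ≤ Fintype.card V - 1 :=
  (treewidth_le_width (TreeDecomposition.trivial G)).trans
    (TreeDecomposition.width_trivial G).le

end treewidth

/-! ### Path decompositions -/

/-- Mathlib's path graph `0 — 1 — ⋯ — k` on `Fin (k + 1)` is a tree: it is connected
(`SimpleGraph.pathGraph_connected`) and has `k` edges `{i, i+1}`, one fewer than vertices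
(`SimpleGraph.isTree_iff_connected_and_card`). [folklore] -/
theorem isTree_pathGraph (k : ℕ) : (pathGraph (k + 1)).IsTree := by
  rw [isTree_iff_connected_and_card]
  refine ⟨pathGraph_connected k, ?_⟩
  have hadj : ∀ i : Fin k, s(i.castSucc, i.succ) ∈ (pathGraph (k + 1)).edgeSet := fun i => by
    rw [mem_edgeSet, pathGraph_adj]
    exact Or.inl (by simp)
  have hbij : Function.Bijective
      (fun i : Fin k => (⟨s(i.castSucc, i.succ), hadj i⟩ : (pathGraph (k + 1)).edgeSet)) := by
    constructor
    · intro i j hij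
      simp only [Subtype.mk.injEq, Sym2.eq_iff] at hij
      rcases hij with ⟨h, -⟩ | ⟨h1, h2⟩
      · exact Fin.castSucc_injective _ h
      · have h1' := congrArg Fin.val h1
        have h2' := congrArg Fin.val h2
        simp only [Fin.val_castSucc, Fin.val_succ] at h1' h2'
        omega
    · rintro ⟨e, he⟩
      induction e using Sym2.ind with
      | _ u v =>
        rw [mem_edgeSet, pathGraph_adj] at he
        have hu := u.isLt
        have hv := v.isLt
        rcases he with h | h
        · refine ⟨⟨u.val, by omega⟩, Subtype.ext ?_⟩
          show s(_, _) = s(u, v)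
          rw [show Fin.castSucc (⟨u.val, by omega⟩ : Fin k) = u from Fin.ext rfl,
            show Fin.succ (⟨u.val, by omega⟩ : Fin k) = v from Fin.ext h]
        · refine ⟨⟨v.val, by omega⟩, Subtype.ext ?_⟩
          show s(_, _) = s(u, v)
          rw [show Fin.castSucc (⟨v.val, by omega⟩ : Fin k) = v from Fin.ext rfl,
            show Fin.succ (⟨v.val, by omega⟩ : Fin k) = u from Fin.ext h, Sym2.eq_swap]
  rw [← Nat.card_eq_of_bijective _ hbij]
  simp

/-- Along a path, two vertices of an order-connected set `S` are joined inside `S`: the walk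
`a — a+1 — ⋯ — b` stays in `S`. [folklore] -/
theorem reachable_induce_pathGraph {k : ℕ} {S : Set (Fin k)} (hS : S.OrdConnected)
    {a b : Fin k} (ha : a ∈ S) (hb : b ∈ S) (hab : a ≤ b) :
    ((pathGraph k).induce S).Reachable ⟨a, ha⟩ ⟨b, hb⟩ := by
  obtain ⟨d, hd⟩ : ∃ d : ℕ, (b : ℕ) = a + d := ⟨b - a, by rw [Fin.le_def] at hab; omega⟩
  induction d generalizing b with
  | zero =>
    have hab' : a = b := Fin.ext (by omega)
    subst hab'
    rfl
  | succ d ih =>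
    have hbk := b.isLt
    set c : Fin k := ⟨a.val + d, by omega⟩ with hc
    have hac : a ≤ c := by rw [Fin.le_def]; simp [c]
    have hcb : c ≤ b := by rw [Fin.le_def]; simp [c]; omega
    have hcS : c ∈ S := hS.out ha hb ⟨hac, hcb⟩
    have h1 := ih hcS hac rfl
    refine h1.trans (Adj.reachable ?_)
    rw [induce_adj, pathGraph_adj]
    exact Or.inl (by simp [c]; omega)

/-- A nonempty order-connected set of vertices of a path (an interval) induces a connected
subgraph. [folklore] -/
theorem connected_induce_pathGraph {k : ℕ} {S : Set (Fin k)} (hS : S.OrdConnected)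
    (hne : S.Nonempty) : ((pathGraph k).induce S).Connected := by
  obtain ⟨s, hs⟩ := hne
  refine (connected_iff _).2 ⟨fun a b => ?_, ⟨⟨s, hs⟩⟩⟩
  rcases le_total (a : Fin k) b with h | h
  · exact reachable_induce_pathGraph hS a.2 b.2 h
  · exact (reachable_induce_pathGraph hS b.2 a.2 h).symm

namespace TreeDecomposition

/-- **Path decompositions from intervals.** Bags `B 0, …, B k` along the path graph form a tree
decomposition of `G` as soon as (T2) every edge of `G` lies in some bag and, for every vertex
`v`, the indices of the bags containing `v` form a nonempty interval (which is (T1)+(T3) for a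
path). This is the shape of Markov–Shi's decomposition `B_1 — B_2 — ⋯ — B_{n-1}` in the proof of
their Prop. 5.1. [cite: MarkovShi2008, §5 (proof of Prop 5.1)] -/
def ofIntervals (G : _root_.SimpleGraph V) {k : ℕ} (B : Fin (k + 1) → Finset V)
    (hadj : ∀ ⦃u v : V⦄, G.Adj u v → ∃ t, u ∈ B t ∧ v ∈ B t)
    (hne : ∀ v, ∃ t, v ∈ B t) (hint : ∀ v, Set.OrdConnected {t | v ∈ B t}) :
    TreeDecomposition G (Fin (k + 1)) where
  tree := pathGraph (k + 1)
  isTree := isTree_pathGraph k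
  bag := B
  exists_mem_bag_of_adj := hadj
  connected_induce v := connected_induce_pathGraph (hint v) (hne v)

/-- The bags of `ofIntervals` are the given ones. [folklore] -/
@[simp] theorem ofIntervals_bag (G : _root_.SimpleGraph V) {k : ℕ} (B : Fin (k + 1) → Finset V)
    (hadj : ∀ ⦃u v : V⦄, G.Adj u v → ∃ t, u ∈ B t ∧ v ∈ B t)
    (hne : ∀ v, ∃ t, v ∈ B t) (hint : ∀ v, Set.OrdConnected {t | v ∈ B t}) (t : Fin (k + 1)) :
    (ofIntervals G B hadj hne hint).bag t = B t :=
  rfl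

end TreeDecomposition

/-- **Treewidth bound from a path decomposition**: under the hypotheses of
`TreeDecomposition.ofIntervals`, if every bag has at most `w + 1` vertices then
`treewidth G ≤ w`. [cite: MarkovShi2008, §5 (proof of Prop 5.1)] -/
theorem treewidth_le_of_intervals [Fintype V] (G : _root_.SimpleGraph V) {k : ℕ}
    (B : Fin (k + 1) → Finset V)
    (hadj : ∀ ⦃u v : V⦄, G.Adj u v → ∃ t, u ∈ B t ∧ v ∈ B t)
    (hne : ∀ v, ∃ t, v ∈ B t) (hint : ∀ v, Set.OrdConnected {t | v ∈ B t})
    {w : ℕ} (hcard : ∀ t, (B t).card ≤ w + 1) : treewidth G ≤ w :=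
  (treewidth_le_width (TreeDecomposition.ofIntervals G B hadj hne hint)).trans
    (TreeDecomposition.width_le _ hcard)


/-! ### Path decompositions read off a grid, row by row -/

/-- Quotient and remainder of `n * i + j` by `n` for `j < n`. [folklore] -/
theorem div_mod_of_lt {n i j : ℕ} (hj : j < n) :
    (n * i + j) / n = i ∧ (n * i + j) % n = j := by
  have hn : 0 < n := by omega
  exact ⟨by rw [Nat.mul_add_div hn, Nat.div_eq_of_lt hj, Nat.add_zero],
    by rw [Nat.mul_add_mod, Nat.mod_eq_of_lt hj]⟩

/-- Reading `s ≤ s'` in the grid `s ↦ (s / n, s % n)`: the rows increase, and within a row the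
columns increase (lexicographic order). [folklore] -/
theorem div_lt_or_mod_le {n s s' : ℕ} (h : s ≤ s') :
    s / n < s' / n ∨ (s / n = s' / n ∧ s % n ≤ s' % n) := by
  rcases (Nat.div_le_div_right h : s / n ≤ s' / n).lt_or_eq with hlt | heq
  · exact Or.inl hlt
  · refine Or.inr ⟨heq, ?_⟩
    have h1 := Nat.div_add_mod s n
    have h2 := Nat.div_add_mod s' n
    rw [heq] at h1
    omega

/-- **Treewidth bound from a grid of bags read row by row.** Bags `B i j` (`i < N` rows,
`j < n` columns), laid along a path in lexicographic order of `(i, j)`, form a path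
decomposition as soon as every edge lies in a bag and, for every vertex `v`, the bags containing
`v` form a nonempty lexicographic interval; hence `treewidth G ≤ w` if all bags have at most
`w + 1` vertices. (The values of `B` outside the grid are irrelevant.) This is the shape of the
decomposition of a circuit graph by (wire position, time) used for Markov–Shi's Prop. 5.1.
[cite: MarkovShi2008, §5 (proof of Prop 5.1)] -/
theorem treewidth_le_of_grid [Fintype V] (G : _root_.SimpleGraph V) {N n : ℕ} (hN : 0 < N)
    (hn : 0 < n) (B : ℕ → ℕ → Finset V)
    (hadj : ∀ ⦃u v : V⦄, G.Adj u v → ∃ i < N, ∃ j < n, u ∈ B i j ∧ v ∈ B i j)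
    (hne : ∀ v, ∃ i < N, ∃ j < n, v ∈ B i j)
    (hint : ∀ (v : V) ⦃i₁ j₁ i j i₂ j₂ : ℕ⦄, i₁ < N → j₁ < n → i < N → j < n → i₂ < N → j₂ < n →
      (i₁ < i ∨ (i₁ = i ∧ j₁ ≤ j)) → (i < i₂ ∨ (i = i₂ ∧ j ≤ j₂)) →
      v ∈ B i₁ j₁ → v ∈ B i₂ j₂ → v ∈ B i j)
    {w : ℕ} (hcard : ∀ i < N, ∀ j < n, (B i j).card ≤ w + 1) : treewidth G ≤ w := by
  obtain ⟨k, hk⟩ : ∃ k, N * n = k + 1 := ⟨N * n - 1, by have := Nat.mul_pos hN hn; omega⟩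
  have hdiv : ∀ s : Fin (k + 1), (s : ℕ) / n < N := fun s =>
    (Nat.div_lt_iff_lt_mul hn).2 (by rw [hk]; exact s.isLt)
  have hmod : ∀ s : Fin (k + 1), (s : ℕ) % n < n := fun s => Nat.mod_lt _ hn
  have hidx : ∀ i < N, ∀ j < n, n * i + j < k + 1 := fun i hi j hj => by
    have h1 : n * (i + 1) ≤ n * N := Nat.mul_le_mul_left n hi
    rw [← hk, Nat.mul_comm N n]
    rw [Nat.mul_add, Nat.mul_one] at h1
    omega
  refine treewidth_le_of_intervals G (fun s : Fin (k + 1) => B ((s : ℕ) / n) ((s : ℕ) % n))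
    ?_ ?_ ?_ fun s => hcard _ (hdiv s) _ (hmod s)
  · intro u v huv
    obtain ⟨i, hi, j, hj, hu, hv⟩ := hadj huv
    refine ⟨⟨n * i + j, hidx i hi j hj⟩, ?_⟩
    simp only [(div_mod_of_lt hj).1, (div_mod_of_lt hj).2]
    exact ⟨hu, hv⟩
  · intro v
    obtain ⟨i, hi, j, hj, hv⟩ := hne v
    refine ⟨⟨n * i + j, hidx i hi j hj⟩, ?_⟩
    simp only [(div_mod_of_lt hj).1, (div_mod_of_lt hj).2]
    exact hv
  · intro v
    exact Set.ordConnected_iff.2 fun s₁ hs₁ s₂ hs₂ _ s ⟨h1, h2⟩ =>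
      hint v (hdiv s₁) (hmod s₁) (hdiv s) (hmod s) (hdiv s₂) (hmod s₂)
        (div_lt_or_mod_le h1) (div_lt_or_mod_le h2) hs₁ hs₂

end Literature.Combinatorics.SimpleGraph
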